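import Summits.BirchSwinnertonDyer.BirchSwinnertonDyer.Theorems.PrintCf2SplitBadTwoCMEigenDecomposition
import Summits.BirchSwinnertonDyer.BirchSwinnertonDyer.Theorems.PrintCf2SplitBadTwoCMPrimaryStructure
import HarnessLib

/-!
# Crux `PrintCf2.SplitBadTwoRankOneOfFacts` (item stmt-BirchSwinnertonDyer-20368), road α over the CM field:
# the CONJUGATION-SWAP COUNT `#M = (#M[𝔭^∞])²`, `ord_p #M = 2 · ord_p #M[𝔭^∞] = 2 · ord_p #M[𝔭̄^∞]`

Cell `bsd-print-cf2`, width seat `bsd-line-cf2-p1-w8` g0 (planner WIDTH BRICK MENU 16:11:50Z, brick **B4**);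
`--supports stmt-BirchSwinnertonDyer-20368` (helper). HONEST FRAMING: nothing here closes a crux or a stub; BSD is not
proved by any of this; no summit statement is proved by this seat. No definition is introduced. beyond-print theorem: no
(linear algebra).

THE STATEMENT (generic, any prime `p`). `M` a `p`-primary abelian group, `π : M →+ M` with `π² = tπ − m` whose roots
`r₁, r₂ ∈ ℤ_p` are `p`-adically separated (`r₁ + r₂ = t`, `r₁ r₂ = m`, `r₁ − r₂ ∈ ℤ_p^×`), `C₁ = M[𝔭^∞]`, `C₂ = M[𝔭̄^∞]` the
two eigen-subgroups of -w2 g7's `exists_eigenDecomposition` (`Theorems/PrintCf2SplitBadTwoCMEigenDecomposition.lean`; here in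
the ∀-form: ANY pair of subgroups with the two membership iffs). Then
* `natCard_eq_mul_of_inf_eq_bot_of_sup_eq_top` / `natCard_eq_natCard_eigen_mul`: `#M = #C₁ · #C₂` (complementary summands);
* if an additive AUTOMORPHISM `g` of `M` conjugates `π` to `π̄ = t − π` (`π g = t g − g π` — complex conjugation acting on a
  `K`-rational CM endomorphism, -w2 g7's `exists_cmPrimaryDecomposition_rat_two`), then `g` restricts to an additive
  ISOMORPHISM `C₁ ≃+ C₂` (`exists_addEquiv_eigen_of_antiEquiv`), so `#C₁ = #C₂` (`natCard_eigen_eq_of_antiEquiv`),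
  **`#M = (#C₁)²`** (`natCard_eq_sq_of_antiEquiv`) and **`ord_p #M = 2 · ord_p #C₁ = 2 · ord_p #C₂`**
  (`padicValNat_natCard_eq_two_mul_of_antiEquiv`); the same for an additive INVOLUTION `g` (`…_of_involutive`);
* §3: the `p = 2`, `π² = π − 2` (`𝓞 = ℤ[(1 + √−7)/2]`, `2 = 𝔭𝔭̄` split) corollaries keyed to ANY root `r` of `X² − X + 2`
  (`natCard_eq_sq_two`, `padicValNat_two_natCard_eq_two_mul`).
All cardinalities are `Nat.card` (`= 0` on infinite carriers), so NO finiteness hypothesis is needed: an infinite `M` has an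
infinite summand and then both sides vanish. Consumers (planner 16:11:50Z B6 / STUB-PLAN `stub_heegnerIndexLowerAtTwo` T3): the
bookkeeping `ord₂ #Ш(W/K₀)[2^∞] = 2 · ord₂ #Ш(W/K₀)[𝔭̄^∞]` for a CM curve `W/ℚ` over `K₀ = ℚ(√−7)`, where complex conjugation is
the swapping involution.

References: elementary (`ℤ_p[X]/(X² − tX + m) ≅ ℤ_p × ℤ_p`); background K. Rubin, LNM 1716 §2; B. H. Gross, *Arithmetic on
elliptic curves with complex multiplication*, LNM 776 (1980) §§11–12 (the `𝔭 ↔ 𝔭̄` symmetry under complex conjugation).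
-/

noncomputable section

open scoped Classical

set_option linter.dupNamespace false
set_option autoImplicit false

namespace Summit.BirchSwinnertonDyer.BirchSwinnertonDyer.Theorems.PrintCf2.CMPrimes

/-! ## §1 Complementary subgroups: `#M = #C₁ · #C₂` -/

section Compl

variable {M : Type*} [AddCommGroup M]

/-- **Complementary subgroups multiply cardinalities.** If `C₁ ⊓ C₂ = ⊥` and `C₁ ⊔ C₂ = ⊤` in an abelian group `M`, then
`(x₁, x₂) ↦ x₁ + x₂` is a bijection `C₁ × C₂ → M`, so `#M = #C₁ · #C₂` (`Nat.card`; both sides `0` when infinite). [folklore] -/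
theorem natCard_eq_mul_of_inf_eq_bot_of_sup_eq_top {C₁ C₂ : AddSubgroup M} (hinf : C₁ ⊓ C₂ = ⊥) (hsup : C₁ ⊔ C₂ = ⊤) :
    Nat.card M = Nat.card C₁ * Nat.card C₂ := by
  rw [← Nat.card_prod]
  refine (Nat.card_eq_of_bijective (fun x : C₁ × C₂ ↦ (x.1 : M) + x.2) ⟨?_, ?_⟩).symm
  · rintro ⟨⟨x₁, hx₁⟩, ⟨x₂, hx₂⟩⟩ ⟨⟨y₁, hy₁⟩, ⟨y₂, hy₂⟩⟩ h
    dsimp only at h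
    -- `x₁ - y₁ = y₂ - x₂ ∈ C₁ ⊓ C₂ = ⊥`
    have hmem : x₁ - y₁ ∈ C₁ ⊓ C₂ := by
      refine AddSubgroup.mem_inf.mpr ⟨C₁.sub_mem hx₁ hy₁, ?_⟩
      have e : x₁ - y₁ = y₂ - x₂ := by
        rw [sub_eq_sub_iff_add_eq_add, h, add_comm]
      rw [e]; exact C₂.sub_mem hy₂ hx₂
    rw [hinf, AddSubgroup.mem_bot, sub_eq_zero] at hmem
    subst hmem
    have h2 : x₂ = y₂ := add_left_cancel h
    subst h2
    rfl
  · intro x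
    have hx : x ∈ C₁ ⊔ C₂ := by rw [hsup]; exact AddSubgroup.mem_top x
    obtain ⟨y, hy, z, hz, rfl⟩ := AddSubgroup.mem_sup.mp hx
    exact ⟨(⟨y, hy⟩, ⟨z, hz⟩), rfl⟩

/-- An additive involution `g` (`g (g x) = x`) of `M` as an additive automorphism `M ≃+ M` with `⇑e = ⇑g`. [folklore] -/
theorem exists_addEquiv_of_involutive (g : M →+ M) (hg : ∀ x, g (g x) = x) :
    ∃ e : M ≃+ M, ∀ x, e x = g x :=
  ⟨{ toFun := g, invFun := g, left_inv := hg, right_inv := hg, map_add' := g.map_add }, fun _ ↦ rfl⟩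

end Compl

/-! ## §2 Generic: the swap count under an anti-commuting automorphism -/

section Generic

variable {p : ℕ} [Fact p.Prime] {M : Type*} [AddCommGroup M]

/-- **`#M = #C₁ · #C₂` for the eigen-decomposition.** `M` `p`-primary, `π² = tπ − m` with separated roots `r₁, r₂`; for ANY
subgroups `C₁, C₂` cut out by the two membership conditions «`π` acts as `rᵢ` at every level», `#M = #C₁ · #C₂`.
(-w2 g7's `exists_eigenDecomposition`: `C₁ ⊓ C₂ = ⊥`, `C₁ ⊔ C₂ = ⊤`.) [folklore] -/
theorem natCard_eq_natCard_eigen_mul (hM : ∀ x : M, ∃ k : ℕ, p ^ k • x = 0) (π : M →+ M) {t m : ℤ}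
    (hπ : ∀ x, π (π x) = t • π x - m • x) {r₁ r₂ : ℤ_[p]} (hsum : r₁ + r₂ = t) (hprod : r₁ * r₂ = m)
    (hunit : IsUnit (r₁ - r₂)) {C₁ C₂ : AddSubgroup M}
    (hC₁ : ∀ x, x ∈ C₁ ↔ ∀ (k : ℕ) (N : ℤ), p ^ k • x = 0 →
      ((N : ℤ_[p]) - r₁) ∈ (Ideal.span {(p : ℤ_[p]) ^ k} : Ideal ℤ_[p]) → π x = N • x)
    (hC₂ : ∀ x, x ∈ C₂ ↔ ∀ (k : ℕ) (N : ℤ), p ^ k • x = 0 →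
      ((N : ℤ_[p]) - r₂) ∈ (Ideal.span {(p : ℤ_[p]) ^ k} : Ideal ℤ_[p]) → π x = N • x) :
    C₁ ⊓ C₂ = ⊥ ∧ C₁ ⊔ C₂ = ⊤ ∧ Nat.card M = Nat.card C₁ * Nat.card C₂ := by
  obtain ⟨D₁, D₂, hD₁, hD₂, hinf, hsup, -, -⟩ := exists_eigenDecomposition hM π hπ hsum hprod hunit
  have e1 : C₁ = D₁ := by ext x; exact (hC₁ x).trans (hD₁ x).symm
  have e2 : C₂ = D₂ := by ext x; exact (hC₂ x).trans (hD₂ x).symm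
  subst e1 e2
  exact ⟨hinf, hsup, natCard_eq_mul_of_inf_eq_bot_of_sup_eq_top hinf hsup⟩

omit [Fact p.Prime] in
/-- The inverse of an automorphism conjugating `π` to `t − π` does the same: from `π g = t g − g π` we get
`π g⁻¹ = t g⁻¹ − g⁻¹ π`. [folklore] -/
theorem anticommute_symm (π : M →+ M) (g : M ≃+ M) {t : ℤ} (hg : ∀ x, π (g x) = t • g x - g (π x)) (y : M) :
    π (g.symm y) = t • g.symm y - g.symm (π y) := by
  apply g.injective
  have h := hg (g.symm y)
  rw [g.apply_symm_apply] at h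
  rw [map_sub, map_zsmul, g.apply_symm_apply, g.apply_symm_apply, h]
  abel

/-- **The swap is an isomorphism of the summands.** `M` `p`-primary, `π : M →+ M`, `r₁ + r₂ = t`, and `g : M ≃+ M` with
`π g = t g − g π`. Then `g` restricts to an additive isomorphism `C₁ ≃+ C₂` between the `r₁`- and the `r₂`-eigen-subgroups
(-w2 g7's `eigen_map_of_anticommute` for `g` and for `g⁻¹`). [folklore] -/
theorem exists_addEquiv_eigen_of_antiEquiv (hM : ∀ x : M, ∃ k : ℕ, p ^ k • x = 0) (π : M →+ M) {t : ℤ}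
    {r₁ r₂ : ℤ_[p]} (hsum : r₁ + r₂ = t) {C₁ C₂ : AddSubgroup M}
    (hC₁ : ∀ x, x ∈ C₁ ↔ ∀ (k : ℕ) (N : ℤ), p ^ k • x = 0 →
      ((N : ℤ_[p]) - r₁) ∈ (Ideal.span {(p : ℤ_[p]) ^ k} : Ideal ℤ_[p]) → π x = N • x)
    (hC₂ : ∀ x, x ∈ C₂ ↔ ∀ (k : ℕ) (N : ℤ), p ^ k • x = 0 →
      ((N : ℤ_[p]) - r₂) ∈ (Ideal.span {(p : ℤ_[p]) ^ k} : Ideal ℤ_[p]) → π x = N • x)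
    (g : M ≃+ M) (hg : ∀ x, π (g x) = t • g x - g (π x)) :
    ∃ e : C₁ ≃+ C₂, ∀ x : C₁, ((e x : C₂) : M) = g x := by
  have hsum' : r₂ + r₁ = t := by rw [add_comm, hsum]
  have hg' := anticommute_symm π g hg
  have h12 : ∀ x ∈ C₁, g x ∈ C₂ := fun x hx ↦
    (hC₂ _).mpr (eigen_map_of_anticommute π (g : M →+ M) hg hsum (hM x) ((hC₁ x).mp hx))
  have h21 : ∀ y ∈ C₂, g.symm y ∈ C₁ := fun y hy ↦
    (hC₁ _).mpr (eigen_map_of_anticommute π (g.symm : M →+ M) hg' hsum' (hM y) ((hC₂ y).mp hy))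
  let e : C₁ ≃+ C₂ :=
    { toFun := fun x ↦ ⟨g x, h12 x x.2⟩,
      invFun := fun y ↦ ⟨g.symm y, h21 y y.2⟩,
      left_inv := fun x ↦ Subtype.ext (g.symm_apply_apply x),
      right_inv := fun y ↦ Subtype.ext (g.apply_symm_apply y),
      map_add' := fun x y ↦ Subtype.ext (by
        change g ((x : M) + y) = g x + g y
        rw [map_add]) }
  exact ⟨e, fun _ ↦ rfl⟩

/-- **`#C₁ = #C₂` under a swapping automorphism.** [folklore] -/
theorem natCard_eigen_eq_of_antiEquiv (hM : ∀ x : M, ∃ k : ℕ, p ^ k • x = 0) (π : M →+ M) {t : ℤ}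
    {r₁ r₂ : ℤ_[p]} (hsum : r₁ + r₂ = t) {C₁ C₂ : AddSubgroup M}
    (hC₁ : ∀ x, x ∈ C₁ ↔ ∀ (k : ℕ) (N : ℤ), p ^ k • x = 0 →
      ((N : ℤ_[p]) - r₁) ∈ (Ideal.span {(p : ℤ_[p]) ^ k} : Ideal ℤ_[p]) → π x = N • x)
    (hC₂ : ∀ x, x ∈ C₂ ↔ ∀ (k : ℕ) (N : ℤ), p ^ k • x = 0 →
      ((N : ℤ_[p]) - r₂) ∈ (Ideal.span {(p : ℤ_[p]) ^ k} : Ideal ℤ_[p]) → π x = N • x)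
    (g : M ≃+ M) (hg : ∀ x, π (g x) = t • g x - g (π x)) :
    Nat.card C₁ = Nat.card C₂ := by
  obtain ⟨e, -⟩ := exists_addEquiv_eigen_of_antiEquiv hM π hsum hC₁ hC₂ g hg
  exact Nat.card_congr e.toEquiv

/-- **THE SWAP COUNT `#M = (#C₁)²`.** `M` `p`-primary, `π² = tπ − m` with `p`-adically separated roots `r₁, r₂`, `C₁`, `C₂` the
two eigen-subgroups (membership conditions), and `g : M ≃+ M` with `π g = t g − g π`. Then `#M = (#C₁)²` (and `= (#C₂)²`).
`Nat.card` throughout: no finiteness hypothesis. [folklore] -/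
theorem natCard_eq_sq_of_antiEquiv (hM : ∀ x : M, ∃ k : ℕ, p ^ k • x = 0) (π : M →+ M) {t m : ℤ}
    (hπ : ∀ x, π (π x) = t • π x - m • x) {r₁ r₂ : ℤ_[p]} (hsum : r₁ + r₂ = t) (hprod : r₁ * r₂ = m)
    (hunit : IsUnit (r₁ - r₂)) {C₁ C₂ : AddSubgroup M}
    (hC₁ : ∀ x, x ∈ C₁ ↔ ∀ (k : ℕ) (N : ℤ), p ^ k • x = 0 →
      ((N : ℤ_[p]) - r₁) ∈ (Ideal.span {(p : ℤ_[p]) ^ k} : Ideal ℤ_[p]) → π x = N • x)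
    (hC₂ : ∀ x, x ∈ C₂ ↔ ∀ (k : ℕ) (N : ℤ), p ^ k • x = 0 →
      ((N : ℤ_[p]) - r₂) ∈ (Ideal.span {(p : ℤ_[p]) ^ k} : Ideal ℤ_[p]) → π x = N • x)
    (g : M ≃+ M) (hg : ∀ x, π (g x) = t • g x - g (π x)) :
    Nat.card M = Nat.card C₁ ^ 2 ∧ Nat.card M = Nat.card C₂ ^ 2 := by
  obtain ⟨-, -, hmul⟩ := natCard_eq_natCard_eigen_mul hM π hπ hsum hprod hunit hC₁ hC₂
  have heq := natCard_eigen_eq_of_antiEquiv hM π hsum hC₁ hC₂ g hg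
  exact ⟨by rw [hmul, heq, sq], by rw [hmul, heq, sq]⟩

/-- **`ord_p #M = 2 · ord_p #C₁ = 2 · ord_p #C₂`** under a swapping automorphism (the form the `Ш`-bookkeeping consumes:
`ord₂ #Ш(W/K₀)[2^∞] = 2 · ord₂ #Ш(W/K₀)[𝔭̄^∞]`). [folklore] -/
theorem padicValNat_natCard_eq_two_mul_of_antiEquiv (hM : ∀ x : M, ∃ k : ℕ, p ^ k • x = 0) (π : M →+ M) {t m : ℤ}
    (hπ : ∀ x, π (π x) = t • π x - m • x) {r₁ r₂ : ℤ_[p]} (hsum : r₁ + r₂ = t) (hprod : r₁ * r₂ = m)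
    (hunit : IsUnit (r₁ - r₂)) {C₁ C₂ : AddSubgroup M}
    (hC₁ : ∀ x, x ∈ C₁ ↔ ∀ (k : ℕ) (N : ℤ), p ^ k • x = 0 →
      ((N : ℤ_[p]) - r₁) ∈ (Ideal.span {(p : ℤ_[p]) ^ k} : Ideal ℤ_[p]) → π x = N • x)
    (hC₂ : ∀ x, x ∈ C₂ ↔ ∀ (k : ℕ) (N : ℤ), p ^ k • x = 0 →
      ((N : ℤ_[p]) - r₂) ∈ (Ideal.span {(p : ℤ_[p]) ^ k} : Ideal ℤ_[p]) → π x = N • x)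
    (g : M ≃+ M) (hg : ∀ x, π (g x) = t • g x - g (π x)) :
    padicValNat p (Nat.card M) = 2 * padicValNat p (Nat.card C₁) ∧
      padicValNat p (Nat.card M) = 2 * padicValNat p (Nat.card C₂) := by
  obtain ⟨h1, h2⟩ := natCard_eq_sq_of_antiEquiv hM π hπ hsum hprod hunit hC₁ hC₂ g hg
  exact ⟨by rw [h1, padicValNat.pow], by rw [h2, padicValNat.pow]⟩

/-- **Involution form.** The same with `g : M →+ M` an additive INVOLUTION (`g (g x) = x`) conjugating `π` to `t − π`
(complex conjugation): `#C₁ = #C₂`, `#M = (#C₁)² = (#C₂)²`, `ord_p #M = 2 · ord_p #C₁ = 2 · ord_p #C₂`. [folklore] -/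
theorem natCard_eq_sq_of_involutive (hM : ∀ x : M, ∃ k : ℕ, p ^ k • x = 0) (π : M →+ M) {t m : ℤ}
    (hπ : ∀ x, π (π x) = t • π x - m • x) {r₁ r₂ : ℤ_[p]} (hsum : r₁ + r₂ = t) (hprod : r₁ * r₂ = m)
    (hunit : IsUnit (r₁ - r₂)) {C₁ C₂ : AddSubgroup M}
    (hC₁ : ∀ x, x ∈ C₁ ↔ ∀ (k : ℕ) (N : ℤ), p ^ k • x = 0 →
      ((N : ℤ_[p]) - r₁) ∈ (Ideal.span {(p : ℤ_[p]) ^ k} : Ideal ℤ_[p]) → π x = N • x)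
    (hC₂ : ∀ x, x ∈ C₂ ↔ ∀ (k : ℕ) (N : ℤ), p ^ k • x = 0 →
      ((N : ℤ_[p]) - r₂) ∈ (Ideal.span {(p : ℤ_[p]) ^ k} : Ideal ℤ_[p]) → π x = N • x)
    (g : M →+ M) (hgg : ∀ x, g (g x) = x) (hg : ∀ x, π (g x) = t • g x - g (π x)) :
    Nat.card C₁ = Nat.card C₂ ∧ Nat.card M = Nat.card C₁ ^ 2 ∧ Nat.card M = Nat.card C₂ ^ 2 ∧
      padicValNat p (Nat.card M) = 2 * padicValNat p (Nat.card C₁) ∧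
      padicValNat p (Nat.card M) = 2 * padicValNat p (Nat.card C₂) := by
  obtain ⟨e, he⟩ := exists_addEquiv_of_involutive g hgg
  have hge : ∀ x, π (e x) = t • e x - e (π x) := fun x ↦ by rw [he, he, hg]
  obtain ⟨h1, h2⟩ := natCard_eq_sq_of_antiEquiv hM π hπ hsum hprod hunit hC₁ hC₂ e hge
  exact ⟨natCard_eigen_eq_of_antiEquiv hM π hsum hC₁ hC₂ e hge, h1, h2,
    by rw [h1, padicValNat.pow], by rw [h2, padicValNat.pow]⟩

end Generic

/-! ## §3 The split prime `2` of `ℤ[(1 + √−7)/2]`: `π² = π − 2`, ANY root `r` of `X² − X + 2` in `ℤ₂` -/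

section Two

variable {M : Type*} [AddCommGroup M]

/-- **`p = 2`, `π² = π − 2`: the swap count.** `M` `2`-primary, `π : M →+ M` with `π(πx) = πx − 2x`, `r ∈ ℤ₂` any root of
`X² − X + 2` (`r̄ = 1 − r`; `r − r̄` is a unit by -w2 g7's `two_dvd_or_two_dvd_one_sub_of_root`), `C = M[𝔭^∞]` (`π` acts as `r`),
`C' = M[𝔭̄^∞]` (`π` acts as `1 − r`), and `g` an additive involution of `M` with `π g = g − g π` (`g π g = π̄`). Then
`#C = #C'` and `#M = (#C)² = (#C')²`. [folklore] -/
theorem natCard_eq_sq_two (hM : ∀ x : M, ∃ k : ℕ, 2 ^ k • x = 0) (π : M →+ M)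
    (hπ : ∀ x, π (π x) = (1 : ℤ) • π x - (2 : ℤ) • x) {r : ℤ_[2]} (hr : r * r = r - 2)
    {C C' : AddSubgroup M}
    (hC : ∀ x, x ∈ C ↔ ∀ (k : ℕ) (N : ℤ), 2 ^ k • x = 0 →
      ((N : ℤ_[2]) - r) ∈ (Ideal.span {(2 : ℤ_[2]) ^ k} : Ideal ℤ_[2]) → π x = N • x)
    (hC' : ∀ x, x ∈ C' ↔ ∀ (k : ℕ) (N : ℤ), 2 ^ k • x = 0 →
      ((N : ℤ_[2]) - (1 - r)) ∈ (Ideal.span {(2 : ℤ_[2]) ^ k} : Ideal ℤ_[2]) → π x = N • x)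
    (g : M →+ M) (hgg : ∀ x, g (g x) = x) (hg : ∀ x, π (g x) = (1 : ℤ) • g x - g (π x)) :
    Nat.card C = Nat.card C' ∧ Nat.card M = Nat.card C ^ 2 ∧ Nat.card M = Nat.card C' ^ 2 := by
  haveI : Fact (Nat.Prime 2) := ⟨Nat.prime_two⟩
  have hsum : r + (1 - r) = ((1 : ℤ) : ℤ_[2]) := by push_cast; ring
  have hprod : r * (1 - r) = ((2 : ℤ) : ℤ_[2]) := by push_cast; linear_combination -hr
  have hunit : IsUnit (r - (1 - r)) := (two_dvd_or_two_dvd_one_sub_of_root hr).2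
  obtain ⟨h0, h1, h2, -, -⟩ :=
    natCard_eq_sq_of_involutive (p := 2) hM π hπ hsum hprod hunit hC hC' g hgg hg
  exact ⟨h0, h1, h2⟩

/-- **`p = 2`, `π² = π − 2`: `ord₂ #M = 2 · ord₂ #M[𝔭^∞] = 2 · ord₂ #M[𝔭̄^∞]`** under an additive involution `g` with
`g π g = π̄` — the shape `ord₂ #Ш(W/K₀)[2^∞] = 2 · ord₂ #Ш(W/K₀)[𝔭̄^∞]` (complex conjugation swaps the two CM-primary parts).
[folklore] -/
theorem padicValNat_two_natCard_eq_two_mul (hM : ∀ x : M, ∃ k : ℕ, 2 ^ k • x = 0) (π : M →+ M)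
    (hπ : ∀ x, π (π x) = (1 : ℤ) • π x - (2 : ℤ) • x) {r : ℤ_[2]} (hr : r * r = r - 2)
    {C C' : AddSubgroup M}
    (hC : ∀ x, x ∈ C ↔ ∀ (k : ℕ) (N : ℤ), 2 ^ k • x = 0 →
      ((N : ℤ_[2]) - r) ∈ (Ideal.span {(2 : ℤ_[2]) ^ k} : Ideal ℤ_[2]) → π x = N • x)
    (hC' : ∀ x, x ∈ C' ↔ ∀ (k : ℕ) (N : ℤ), 2 ^ k • x = 0 →
      ((N : ℤ_[2]) - (1 - r)) ∈ (Ideal.span {(2 : ℤ_[2]) ^ k} : Ideal ℤ_[2]) → π x = N • x)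
    (g : M →+ M) (hgg : ∀ x, g (g x) = x) (hg : ∀ x, π (g x) = (1 : ℤ) • g x - g (π x)) :
    padicValNat 2 (Nat.card M) = 2 * padicValNat 2 (Nat.card C) ∧
      padicValNat 2 (Nat.card M) = 2 * padicValNat 2 (Nat.card C') := by
  haveI : Fact (Nat.Prime 2) := ⟨Nat.prime_two⟩
  obtain ⟨-, h1, h2⟩ := natCard_eq_sq_two hM π hπ hr hC hC' g hgg hg
  exact ⟨by rw [h1, padicValNat.pow], by rw [h2, padicValNat.pow]⟩

end Two

end Summit.BirchSwinnertonDyer.BirchSwinnertonDyer.Theorems.PrintCf2.CMPrimes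

end
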